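import Mathlib.Topology.Instances.ZMod
import Literature.AnabelianGeometry.AbsoluteAnabelian.GaloisSectionsFacts
import HarnessLib

/-!
# [GalSect] Thm 1.3 (ii): `GalSect.Thm_1_3_ii_points P` (FACT-LIST F-0104) is a SCHEMA over free point data —
# universal closure refuted, instance forms recorded

S. Mochizuki, *Galois sections in absolute anabelian geometry*, Nagoya Math. J. 179 (2005) 17–45
[MochizukiGalSect2005], Thm 1.3 (ii) p. 6 (kurims manuscript pagination, lit key `paper:url-1b7afe4e6889`):
"The subgroup `D_x` is commensurably terminal in `Π_{X_K}`" — for the decomposition group `D_x ⊆ Π_{X_K}` of a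
closed point `x` of a hyperbolic curve `X_K` over a local field.

PROOF-ONLY companion of `GaloisSectionsFacts.lean` (abc-iut-L4-t?, block W2-B12), abc-iut cell seat
abc-iut-f-097 (block F, tranche 97).  The trunk file types the sentence as the θ shape-(1) PREDICATE
`Thm_1_3_ii_points (P : PointData E) := ∀ x, IsCommensurablyTerminal (P.decomp x)` over ARBITRARY point data
`P` (a type of points and ANY family of closed subgroups `P.decomp`) of an ARBITRARY extension `E`; nothing ties
`P.decomp x` to a decomposition group of a curve.  FACT-LIST row **F-0104** (`fact-open`, class preparatory,
kernel_closedness `parametrised`) is therefore a schema (R5): its universal closure is false as soon as `Π` is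
nontrivial (take `D_x := {1}`, whose commensurator is all of `Π`), and the row is admissible only through
instance forms.  Its one consumer is the model-relative wrapper `GalSect.Thm_1_3_ii_model`
(`CuspidalizationFactsModel.lean`), itself a named fact over an abstract `CurveModel` (no model of the étale
`π₁` is in the tree — FOUNDATIONS row 12), so no curve instance is available to discharge; what the kernel CAN
record is below.  Sibling file: `GaloisSectionsFactsSchemaNegative.lean` (abc-iut-f-096) does the same for the
cuspidal clause `Thm_1_3_ii_cusps` (F-0103), Lem. 3.1 (F-0101) and Cor. 3.2 (F-0100), with the same
two-line computation `C_G({1}) = G ≠ {1}` (its `GalSect.not_isCommensurablyTerminal_bot`; inlined below so that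
the two companions are build-independent).

* `commensurator_top`, `isCommensurablyTerminal_top` — `C_G(G) = G`: the full subgroup is commensurably
  terminal;
* `GalSect.thm_1_3_ii_points_iff` (unfolding), `GalSect.thm_1_3_ii_points_of_isEmpty` (no closed points),
  `GalSect.thm_1_3_ii_points_of_decomp_eq_top` (all `D_x = Π`) — the degenerate instance forms that hold;
* `GalSect.not_thm_1_3_ii_points_bot`, `GalSect.exists_not_thm_1_3_ii_points` — at EVERY extension with
  nontrivial `Π` some point data violate the predicate (it is a genuine hypothesis on `P.decomp`);
* `GalSect.not_forall_thm_1_3_ii_points` — the universal closure of F-0104 is false (witness: the point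
  extension `Π = G = ℤ/2`, one point with `D_x = 1`).

HONEST FRAMING: [GalSect] Thm 1.3 (ii) is a refereed, undisputed theorem about decomposition groups of curves;
what is refuted here is only the closure of the cell's free-data typing, a statement about the schema, not about
the paper.  Nothing here bears on the disputed [IUTchIII] Cor. 3.12; typed ≠ proved; no side taken.
-/

open scoped Pointwise

namespace Literature.AnabelianGeometry.AbsoluteAnabelian

universe u

/-! ### The commensurator of the full subgroup -/

section Commensurator

variable {G : Type u} [Group G]

/-- Conjugation fixes the full subgroup. [folklore] -/
private theorem conjAct_smul_top (g : G) : ConjAct.toConjAct g • (⊤ : Subgroup G) = ⊤ :=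
  eq_top_iff.mpr fun x _ => by
    rw [Subgroup.mem_pointwise_smul_iff_inv_smul_mem]
    exact Subgroup.mem_top _

/-- `C_G(G) = G`. [cite: MochizukiAbsAnab2004, Def 0.1 (iii) p.4] -/
theorem commensurator_top : Subgroup.Commensurable.commensurator (⊤ : Subgroup G) = ⊤ :=
  eq_top_iff.mpr fun g _ => by
    -- `Commensurable ⊤ ⊤` is closed by `rfl` (`Subgroup.Commensurable.refl` is a `@[refl]` lemma)
    rw [Subgroup.Commensurable.commensurator_mem_iff, conjAct_smul_top g]

/-- The full subgroup is commensurably terminal. [cite: MochizukiAbsAnab2004, Def 0.1 (iii) p.4] -/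
theorem isCommensurablyTerminal_top : IsCommensurablyTerminal (⊤ : Subgroup G) :=
  ⟨commensurator_top⟩

end Commensurator

namespace GalSect

variable {E : FundamentalExtension.{u}}

/-! ### Instance forms of `Thm_1_3_ii_points` that hold -/

/-- Unfolding: `Thm_1_3_ii_points P` says `C_Π(D_x) = D_x` for every point `x` of the data `P`.
[cite: MochizukiGalSect2005, Thm 1.3 (ii) p.6] -/
theorem thm_1_3_ii_points_iff (P : PointData E) :
    Thm_1_3_ii_points P ↔ ∀ x, Subgroup.Commensurable.commensurator (P.decomp x) = P.decomp x :=
  forall_congr' fun _ => isCommensurablyTerminal_iff _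

/-- Vacuous instance: point data without points satisfy the predicate.
[cite: MochizukiGalSect2005, Thm 1.3 (ii) p.6] -/
theorem thm_1_3_ii_points_of_isEmpty (P : PointData E) [IsEmpty P.Point] : Thm_1_3_ii_points P :=
  fun x => isEmptyElim x

/-- Degenerate instance: if every `D_x` is all of `Π`, the predicate holds (`C_Π(Π) = Π`).
[cite: MochizukiGalSect2005, Thm 1.3 (ii) p.6] -/
theorem thm_1_3_ii_points_of_decomp_eq_top (P : PointData E) (h : ∀ x, P.decomp x = ⊤) :
    Thm_1_3_ii_points P := by
  intro x
  rw [h x]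
  exact isCommensurablyTerminal_top

/-! ### The universal closure of F-0104 is false -/

/-- **F-0104 is a schema**: over an extension with nontrivial `Π`, the point data whose "decomposition groups"
are all trivial (`D_x := {1}`, closed) VIOLATE `Thm_1_3_ii_points` (`C_Π({1}) = Π ≠ {1}`).
[cite: MochizukiGalSect2005, Thm 1.3 (ii) p.6] -/
theorem not_thm_1_3_ii_points_bot [Nontrivial E.arith] (Pt : Type u) [Nonempty Pt] (IsAlg : Pt → Prop) :
    ¬ Thm_1_3_ii_points
      (⟨Pt, fun _ => ⊥, fun _ => by rw [Subgroup.coe_bot]; exact isClosed_singleton, IsAlg⟩ : PointData E) :=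
  fun h => bot_ne_top <| (h (Classical.arbitrary Pt)).commensurator_eq.symm.trans <|
    eq_top_iff.mpr fun g _ => by
      -- `C_Π({1}) = Π`: closed by `rfl` (`Subgroup.Commensurable.refl` is a `@[refl]` lemma)
      rw [Subgroup.Commensurable.commensurator_mem_iff,
        (Subgroup.smul_bot (ConjAct.toConjAct g) : ConjAct.toConjAct g • (⊥ : Subgroup E.arith) = ⊥)]

/-- At EVERY extension with nontrivial `Π` some point data violate `Thm_1_3_ii_points`: the predicate is a
genuine hypothesis on the decomposition data, not a property of `Π ↠ G`.
[cite: MochizukiGalSect2005, Thm 1.3 (ii) p.6] -/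
theorem exists_not_thm_1_3_ii_points (E : FundamentalExtension.{u}) [Nontrivial E.arith] :
    ∃ P : PointData E, ¬ Thm_1_3_ii_points P :=
  ⟨_, not_thm_1_3_ii_points_bot PUnit.{u + 1} fun _ => True⟩

/-- **The universal closure of F-0104 is false** (witness: the point extension `Π = G = ℤ/2ℤ` with the identity
augmentation, one closed point with `D_x = 1`).  The printed theorem concerns decomposition groups of curves,
an instance the tree cannot yet form. [cite: MochizukiGalSect2005, Thm 1.3 (ii) p.6] -/
theorem not_forall_thm_1_3_ii_points :
    ¬ ∀ (E : FundamentalExtension.{0}) (P : PointData E), Thm_1_3_ii_points P := by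
  intro h
  let Gp : ProfiniteGrp.{0} := ProfiniteGrp.of (Multiplicative (ZMod 2))
  let E : FundamentalExtension.{0} :=
    { arith := Gp, gal := Gp, aug := ContinuousMonoidHom.id _, aug_surjective := Function.surjective_id }
  haveI : Nontrivial E.arith :=
    ⟨⟨Multiplicative.ofAdd (0 : ZMod 2), Multiplicative.ofAdd (1 : ZMod 2),
      Multiplicative.ofAdd.injective.ne (by decide : (0 : ZMod 2) ≠ 1)⟩⟩
  obtain ⟨P, hP⟩ := exists_not_thm_1_3_ii_points E
  exact hP (h E P)

end GalSect

end Literature.AnabelianGeometry.AbsoluteAnabelian
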